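import Summits.AnomalousDissipation.AnomalousDissipation.Theorems.FloorCertificate.Negative.Uniform

/-!
# `TaylorCertificates.FloorCertificate` (stmt-AnomalousDissipation-14091) — negative side IV, tools for the
# INJECTED frozen-multiplier beat (`Negative/FixedMultiplier.lean`)

Support lemmas (cdisprove seat `refuter-cdisprove-stmt-AnomalousDissipation-14091-g2-0`, cycle 2, 2026-08-16)
for the refutation `not_floorCertificateFixedMultiplier` (ONE cylindrical multiplier `Φ₁` chosen before `ν`,
weight `θ₁(ν) ≤ 0` free): written over the tree's objects, no new definitions.

* `norm_dotc_le` — `|κ · z| ≤ |κ| ‖z‖`; `sqrt_freqNormSq_le_sum_abs` — `|κ| ≤ ∑ⱼ |κⱼ|`;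
* `tendsto_weighted_fc_ray` — WEIGHTED Riemann–Lebesgue along a lattice ray for a smooth field:
  `|κ_t| ‖ĝ(κ_t)‖ → 0` (the coefficients of `∂ⱼ g` are summable);
* `exists_fc_grad_ne_zero_at` — a multiplier pushing against `f` at a state `u` has a nonzero mode;
* `inertial_three_exact` — the exact inertial term of an injected mode plus two transversal waves against
  ANY smooth field: the beat at `q` plus nine explicit tail terms (no band limitation assumed);
* `tendsto_tail` — each tail term tends to zero along an escaping ray of states whose cylindrical coefficients
  converge (weighted Riemann–Lebesgue for the finitely many test fields).
-/

noncomputable section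

set_option linter.dupNamespace false

open MeasureTheory UnitAddTorus Matrix Filter Topology
open scoped InnerProductSpace ENNReal ComplexConjugate

namespace Summit.AnomalousDissipation.AnomalousDissipation.Theorems.FloorCertificate.Negative

open Literature.Analysis.FunctionSpaces Literature.Analysis.FluidPDE
open Summit.AnomalousDissipation.AnomalousDissipation.Theses.TaylorCertificates
open Summit.AnomalousDissipation.AnomalousDissipation.Theorems.TaylorCertificatePair.Negative

/-! ### Norm bounds for the transversal product -/

/-- Cauchy–Schwarz for the transversal product: `|κ · z| ≤ |κ| ‖z‖`. -/
theorem norm_dotc_le (κ : Fin 3 → ℤ) (z : (EuclideanSpace ℂ (Fin 3))) :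
    ‖((fun j => ((κ) j : ℂ)) ⬝ᵥ (WithLp.ofLp (z)))‖ ≤ Real.sqrt (Torus.freqNormSq κ) * ‖z‖ := by
  have h1 : ‖((fun j => ((κ) j : ℂ)) ⬝ᵥ (WithLp.ofLp (z)))‖ = ‖⟪z, EuclideanSpace.complexify (WithLp.toLp 2 ((fun i => ((κ) i : ℝ))))⟫_ℂ‖ := by
    rw [inner_complexify_castR, Complex.norm_conj]
  have h2 : ‖(EuclideanSpace.complexify (WithLp.toLp 2 ((fun i => ((κ) i : ℝ)))) : EuclideanSpace ℂ (Fin 3))‖ = Real.sqrt (Torus.freqNormSq κ) := by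
    rw [EuclideanSpace.norm_complexify, ← Real.sqrt_sq (norm_nonneg _), norm_sq_toLp, ← freqNormSq_eq_castR_dot]
  rw [h1]
  calc ‖⟪z, EuclideanSpace.complexify (WithLp.toLp 2 ((fun i => ((κ) i : ℝ))))⟫_ℂ‖
      ≤ ‖z‖ * ‖(EuclideanSpace.complexify (WithLp.toLp 2 ((fun i => ((κ) i : ℝ)))) : EuclideanSpace ℂ (Fin 3))‖ := norm_inner_le_norm _ _
    _ = Real.sqrt (Torus.freqNormSq κ) * ‖z‖ := by rw [h2, mul_comm]

/-- `|κ| ≤ ∑ⱼ |κⱼ|` on the lattice. -/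
theorem sqrt_freqNormSq_le_sum_abs (κ : Fin 3 → ℤ) :
    Real.sqrt (Torus.freqNormSq κ) ≤ ∑ j, |((κ j : ℤ) : ℝ)| := by
  rw [Real.sqrt_le_left (Finset.sum_nonneg fun j _ => abs_nonneg _)]
  simp only [Torus.freqNormSq, Fin.sum_univ_three]
  nlinarith [abs_nonneg ((κ 0 : ℤ) : ℝ), abs_nonneg ((κ 1 : ℤ) : ℝ), abs_nonneg ((κ 2 : ℤ) : ℝ),
    sq_abs ((κ 0 : ℤ) : ℝ), sq_abs ((κ 1 : ℤ) : ℝ), sq_abs ((κ 2 : ℤ) : ℝ)]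

/-! ### Weighted Riemann–Lebesgue along a lattice ray -/

/-- The coefficients of a partial derivative: `‖𝓕(∂ⱼ g)(κ)‖ = 2π |κⱼ| ‖ĝ(κ)‖`. -/
theorem norm_fc_partialDeriv {g : (UnitAddTorus (Fin 3)) → (EuclideanSpace ℝ (Fin 3))} (hg : Torus.IsSmooth g) (j : Fin 3) (κ : Fin 3 → ℤ) :
    ‖mFourierCoeff (EuclideanSpace.complexify ∘ Torus.partialDeriv j g) κ‖ = 2 * Real.pi * |((κ j : ℤ) : ℝ)| * ‖mFourierCoeff (EuclideanSpace.complexify ∘ g) κ‖ := by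
  rw [Torus.mFourierCoeff_complexify_partialDeriv hg j κ, norm_smul]
  congr 1
  rw [norm_mul, norm_mul, norm_mul, Complex.norm_ofNat, Complex.norm_real, Real.norm_of_nonneg Real.pi_pos.le,
    Complex.norm_I, mul_one, Complex.norm_intCast]

/-- **Weighted Riemann–Lebesgue along a ray**: `|κ_t| ‖ĝ(κ_t)‖ → 0` along `κ_t = t s + c` (`s ≠ 0`) for a
smooth field `g` (the coefficients of each `∂ⱼ g` are absolutely summable). -/
theorem tendsto_weighted_fc_ray {g : (UnitAddTorus (Fin 3)) → (EuclideanSpace ℝ (Fin 3))} (hg : Torus.IsSmooth g) {s : Fin 3 → ℤ} (hs : s ≠ 0)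
    (c : Fin 3 → ℤ) :
    Tendsto (fun t : ℕ => Real.sqrt (Torus.freqNormSq ((fun i => (t : ℤ) * s i) + c)) *
      ‖mFourierCoeff (EuclideanSpace.complexify ∘ g) ((fun i => (t : ℤ) * s i) + c)‖) atTop (𝓝 0) := by
  -- each `|κⱼ| ‖ĝ(κ)‖` tends to zero along the ray
  have hj : ∀ j : Fin 3, Tendsto (fun t : ℕ => |((((fun i => (t : ℤ) * s i) + c) j : ℤ) : ℝ)| *
      ‖mFourierCoeff (EuclideanSpace.complexify ∘ g) ((fun i => (t : ℤ) * s i) + c)‖) atTop (𝓝 0) := by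
    intro j
    have h1 : Tendsto (fun t : ℕ => ‖mFourierCoeff (EuclideanSpace.complexify ∘ Torus.partialDeriv j g) ((fun i => (t : ℤ) * s i) + c)‖)
        atTop (𝓝 0) := tendsto_fc_ray (hg.partialDeriv j) hs c
    have h2 : ∀ t : ℕ, |((((fun i => (t : ℤ) * s i) + c) j : ℤ) : ℝ)| *
        ‖mFourierCoeff (EuclideanSpace.complexify ∘ g) ((fun i => (t : ℤ) * s i) + c)‖ =
        (2 * Real.pi)⁻¹ * ‖mFourierCoeff (EuclideanSpace.complexify ∘ Torus.partialDeriv j g) ((fun i => (t : ℤ) * s i) + c)‖ := by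
      intro t
      rw [norm_fc_partialDeriv hg j]
      field_simp
    simp_rw [h2]
    simpa using h1.const_mul ((2 * Real.pi)⁻¹)
  have hsum : Tendsto (fun t : ℕ => ∑ j, |((((fun i => (t : ℤ) * s i) + c) j : ℤ) : ℝ)| *
      ‖mFourierCoeff (EuclideanSpace.complexify ∘ g) ((fun i => (t : ℤ) * s i) + c)‖) atTop (𝓝 0) := by
    simpa using tendsto_finsetSum Finset.univ fun j _ => hj j
  refine squeeze_zero (fun t => by positivity) (fun t => ?_) hsum
  rw [← Finset.sum_mul]
  exact mul_le_mul_of_nonneg_right (sqrt_freqNormSq_le_sum_abs _) (norm_nonneg _)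

/-! ### A multiplier pushing against the force at a state has a nonzero mode -/

/-- If `(f, Φ'(u)) > 0` then `Φ'(u)` has a nonzero Fourier mode `q ≠ 0`. -/
theorem exists_fc_grad_ne_zero_at (Φ : Torus.CylindricalTest (Fin 3)) (u : (Torus.energySpace (Fin 3)))
    {f : (UnitAddTorus (Fin 3) → EuclideanSpace ℝ (Fin 3))} (hpos : 0 < ∫ x, ⟪f x, Φ.grad u x⟫_ℝ) :
    ∃ q : Fin 3 → ℤ, q ≠ 0 ∧ mFourierCoeff (EuclideanSpace.complexify ∘ Φ.grad u) q ≠ 0 := by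
  by_contra h
  push Not at h
  have hall : ∀ κ, mFourierCoeff (EuclideanSpace.complexify ∘ Φ.grad u) κ = 0 := by
    intro κ
    by_cases hκ : κ = 0
    · rw [hκ]; exact fc_grad_zero Φ u
    · exact h κ hκ
  have hzero : (EuclideanSpace.complexify ∘ Φ.grad u) = 0 :=
    Torus.eq_zero_of_forall_mFourierCoeff_eq_zero (isSmooth_grad Φ u).complexify_comp.continuous hall
  have hgrad : ∀ x, Φ.grad u x = 0 := by
    intro x
    have hx := congrFun hzero x
    simp only [Function.comp_apply, Pi.zero_apply] at hx
    have hn : ‖Φ.grad u x‖ = 0 := by rw [← EuclideanSpace.norm_complexify, hx, norm_zero]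
    exact norm_eq_zero.1 hn
  have : (∫ x, ⟪f x, Φ.grad u x⟫_ℝ) = 0 := by
    simp [hgrad]
  linarith

/-! ### The exact inertial term of an injected mode plus two waves against any smooth field -/

set_option maxHeartbeats 1000000 in
/-- **Injected mode + two waves, exact.** Inertial term of `Re(e_{k₀} zs) + Re(e_p zA) + Re(e_{p+q} zB)` against
a smooth `G` (transversality `zs ⊥ k₀`, `zA ⊥ p`, `zB ⊥ p + q`, `zB ⊥ p`, `zB ⊥ q`): the BEAT at `q` plus the nine
tail terms at `k₀ ± p`, `k₀ ± (p + q)`, `2p + q` (everything else vanishes identically). -/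
theorem inertial_three_exact {G : (UnitAddTorus (Fin 3)) → (EuclideanSpace ℝ (Fin 3))} (hG : Torus.IsSmooth G)
    (k₀ p q : Fin 3 → ℤ) (zs zA zB : (EuclideanSpace ℂ (Fin 3)))
    (hs : ((fun j => ((k₀) j : ℂ)) ⬝ᵥ (WithLp.ofLp (zs))) = 0)
    (hA : ((fun j => ((p) j : ℂ)) ⬝ᵥ (WithLp.ofLp (zA))) = 0)
    (hB : ((fun j => (((p + q)) j : ℂ)) ⬝ᵥ (WithLp.ofLp (zB))) = 0)
    (hpB : ((fun j => ((p) j : ℂ)) ⬝ᵥ (WithLp.ofLp (zB))) = 0)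
    (hqB : ((fun j => ((q) j : ℂ)) ⬝ᵥ (WithLp.ofLp (zB))) = 0) :
    ∫ x, ⟪Torus.fderiv G x ((∑ mm, Torus.realTrigPoly {![k₀, p, p + q] mm} (fun _ => ![zs, zA, zB] mm)) x),
        (∑ mm, Torus.realTrigPoly {![k₀, p, p + q] mm} (fun _ => ![zs, zA, zB] mm)) x⟫_ℝ =
      Real.pi * ((((fun j => (((k₀ + p)) j : ℂ)) ⬝ᵥ (WithLp.ofLp (zs)))) * ⟪(mFourierCoeff (EuclideanSpace.complexify ∘ G) (k₀ + p)), zA⟫_ℂ).im +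
            Real.pi * (conj (((fun j => (((p - k₀)) j : ℂ)) ⬝ᵥ (WithLp.ofLp (zs)))) * ⟪(mFourierCoeff (EuclideanSpace.complexify ∘ G) (p - k₀)), zA⟫_ℂ).im +
          (Real.pi * ((((fun j => (((k₀ + (p + q))) j : ℂ)) ⬝ᵥ (WithLp.ofLp (zs)))) * ⟪(mFourierCoeff (EuclideanSpace.complexify ∘ G) (k₀ + (p + q))), zB⟫_ℂ).im +
            Real.pi * (conj (((fun j => (((p + q - k₀)) j : ℂ)) ⬝ᵥ (WithLp.ofLp (zs)))) * ⟪(mFourierCoeff (EuclideanSpace.complexify ∘ G) (p + q - k₀)), zB⟫_ℂ).im) +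
        (Real.pi * ((((fun j => (((p + k₀)) j : ℂ)) ⬝ᵥ (WithLp.ofLp (zA)))) * ⟪(mFourierCoeff (EuclideanSpace.complexify ∘ G) (p + k₀)), zs⟫_ℂ).im +
            Real.pi * (conj (((fun j => (((k₀ - p)) j : ℂ)) ⬝ᵥ (WithLp.ofLp (zA)))) * ⟪(mFourierCoeff (EuclideanSpace.complexify ∘ G) (k₀ - p)), zs⟫_ℂ).im +
          (Real.pi * ((((fun j => (((p + (p + q))) j : ℂ)) ⬝ᵥ (WithLp.ofLp (zA)))) * ⟪(mFourierCoeff (EuclideanSpace.complexify ∘ G) (p + (p + q))), zB⟫_ℂ).im +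
            Real.pi * (conj (((fun j => ((q) j : ℂ)) ⬝ᵥ (WithLp.ofLp (zA)))) * ⟪(mFourierCoeff (EuclideanSpace.complexify ∘ G) q), zB⟫_ℂ).im)) +
      (Real.pi * ((((fun j => (((p + q + k₀)) j : ℂ)) ⬝ᵥ (WithLp.ofLp (zB)))) * ⟪(mFourierCoeff (EuclideanSpace.complexify ∘ G) (p + q + k₀)), zs⟫_ℂ).im +
        Real.pi * (conj (((fun j => (((k₀ - (p + q))) j : ℂ)) ⬝ᵥ (WithLp.ofLp (zB)))) * ⟪(mFourierCoeff (EuclideanSpace.complexify ∘ G) (k₀ - (p + q))), zs⟫_ℂ).im) := by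
  rw [inertial_modes hG]
  have e1 : p + q - p = q := add_sub_cancel_left p q
  have e2' : p - (p + q) = -q := by abel
  have d00 : ((fun j => (((k₀ + k₀)) j : ℂ)) ⬝ᵥ (WithLp.ofLp (zs))) = 0 := by rw [dotc_add_left, hs, add_zero]
  have d11 : ((fun j => (((p + p)) j : ℂ)) ⬝ᵥ (WithLp.ofLp (zA))) = 0 := by rw [dotc_add_left, hA, add_zero]
  have d22 : ((fun j => (((p + q + (p + q))) j : ℂ)) ⬝ᵥ (WithLp.ofLp (zB))) = 0 := by rw [dotc_add_left, hB, add_zero]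
  have d21 : ((fun j => (((p + q + p)) j : ℂ)) ⬝ᵥ (WithLp.ofLp (zB))) = 0 := by rw [dotc_add_left, hB, hpB, add_zero]
  have dnq : ((fun j => (((-q)) j : ℂ)) ⬝ᵥ (WithLp.ofLp (zB))) = 0 := by rw [dotc_neg_left, hqB, neg_zero]
  have hA2 : ((fun j => (((p + q - p)) j : ℂ)) ⬝ᵥ (WithLp.ofLp (zA))) = ((fun j => ((q) j : ℂ)) ⬝ᵥ (WithLp.ofLp (zA))) := by rw [e1]
  simp only [Fin.sum_univ_three, Matrix.cons_val_zero, Matrix.cons_val_one, Matrix.cons_val_two,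
    Matrix.head_cons, Matrix.tail_cons, sub_self, dotc_zero_left, d00, d11, d22, d21, hA2, e2', dnq,
    zero_mul, mul_zero, map_zero, Complex.zero_im, add_zero, zero_add]
  rw [e1]

/-! ### Tails of the injected three-mode state along an escaping ray -/

/-- **A tail term tends to zero.** Along states `u t` whose cylindrical coefficients converge, a pair-formula term
`π Im[a_t ⟪𝓕(Φ'(u t))(κ_t), w⟫]` with `|a_t| ≤ |κ_t| ‖z‖` and `κ_t` escaping along a lattice ray tends to zero
(weighted Riemann–Lebesgue for the finitely many smooth test fields). -/
theorem tendsto_tail (Φ : Torus.CylindricalTest (Fin 3)) (u : ℕ → (Torus.energySpace (Fin 3))) {cinf : Fin Φ.m → ℝ}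
    (hL3 : ∀ i, Tendsto (fun t => _root_.fderiv ℝ Φ.φ (Φ.coords (u t)) (EuclideanSpace.single i 1)) atTop (𝓝 (cinf i)))
    (κ : ℕ → (Fin 3 → ℤ)) {s c0 : Fin 3 → ℤ} (hs : s ≠ 0) (hκ : ∀ t, κ t = (fun i => (t : ℤ) * s i) + c0)
    (a : ℕ → ℂ) (z w : (EuclideanSpace ℂ (Fin 3))) (ha : ∀ t, ‖a t‖ ≤ Real.sqrt (Torus.freqNormSq (κ t)) * ‖z‖) :
    Tendsto (fun t => Real.pi * (a t * ⟪mFourierCoeff (EuclideanSpace.complexify ∘ Φ.grad (u t)) (κ t), w⟫_ℂ).im) atTop (𝓝 0) := by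
  have hb : Tendsto (fun t => ∑ i, |_root_.fderiv ℝ Φ.φ (Φ.coords (u t)) (EuclideanSpace.single i 1)| *
      (Real.sqrt (Torus.freqNormSq (κ t)) * ‖mFourierCoeff (EuclideanSpace.complexify ∘ Φ.g i) (κ t)‖)) atTop (𝓝 0) := by
    have : Tendsto (fun t => ∑ i, |_root_.fderiv ℝ Φ.φ (Φ.coords (u t)) (EuclideanSpace.single i 1)| *
        (Real.sqrt (Torus.freqNormSq (κ t)) * ‖mFourierCoeff (EuclideanSpace.complexify ∘ Φ.g i) (κ t)‖)) atTop
        (𝓝 (∑ i, |cinf i| * 0)) := by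
      refine tendsto_finsetSum _ fun i _ => (hL3 i).abs.mul ?_
      have h := tendsto_weighted_fc_ray (Φ.g_smooth i) hs c0
      refine h.congr fun t => ?_
      rw [hκ t]
    simpa using this
  refine squeeze_zero_norm (fun t => ?_) (by simpa using hb.const_mul (Real.pi * ‖z‖ * ‖w‖))
  have h1 := norm_fc_grad_le Φ (u t) (κ t)
  have h2 := ha t
  have hsq : 0 ≤ Real.sqrt (Torus.freqNormSq (κ t)) := Real.sqrt_nonneg _
  calc ‖Real.pi * (a t * ⟪mFourierCoeff (EuclideanSpace.complexify ∘ Φ.grad (u t)) (κ t), w⟫_ℂ).im‖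
      ≤ Real.pi * ‖a t‖ * ‖w‖ * ‖mFourierCoeff (EuclideanSpace.complexify ∘ Φ.grad (u t)) (κ t)‖ := norm_pi_mul_im_le _ _ _
    _ ≤ Real.pi * (Real.sqrt (Torus.freqNormSq (κ t)) * ‖z‖) * ‖w‖ *
          (∑ i, |_root_.fderiv ℝ Φ.φ (Φ.coords (u t)) (EuclideanSpace.single i 1)| * ‖mFourierCoeff (EuclideanSpace.complexify ∘ Φ.g i) (κ t)‖) := by
        have hx : 0 ≤ Real.pi * ‖a t‖ * ‖w‖ := by positivity
        have hy : Real.pi * ‖a t‖ * ‖w‖ ≤ Real.pi * (Real.sqrt (Torus.freqNormSq (κ t)) * ‖z‖) * ‖w‖ :=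
          mul_le_mul_of_nonneg_right (mul_le_mul_of_nonneg_left h2 Real.pi_pos.le) (norm_nonneg _)
        exact mul_le_mul hy h1 (norm_nonneg _) (by positivity)
    _ = Real.pi * ‖z‖ * ‖w‖ * ∑ i, |_root_.fderiv ℝ Φ.φ (Φ.coords (u t)) (EuclideanSpace.single i 1)| *
          (Real.sqrt (Torus.freqNormSq (κ t)) * ‖mFourierCoeff (EuclideanSpace.complexify ∘ Φ.g i) (κ t)‖) := by
        rw [Finset.mul_sum, Finset.mul_sum]
        exact Finset.sum_congr rfl fun i _ => by ring

end Summit.AnomalousDissipation.AnomalousDissipation.Theorems.FloorCertificate.Negative
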